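import Summits.QuantumAdvantage.QuantumAdvantage.Theorems.CubicForrelationNearExactIsExactTwelvePartnerR2Blocks
import Summits.QuantumAdvantage.QuantumAdvantage.Theorems.CubicForrelationNearExactIsExactTwelvePartnerLeaves

/-!
# Crux `CubicForrelation.NearExactIsExact` (stmt-QuantumAdvantage-14043) — n = 12, E1280-even, R2 leaf s₀ω₆ ASSEMBLED
  (E1280-HANDPROOFS.md §1.4): frame data + light structure + pairing partner ⇒ contradiction

Certificate seat `b2b-cforr-cert` (gen 39).  HONEST FRAMING: kernel-checked (standard axioms) end-to-end version of the leaf s₀ω₆ in the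
coefficient-tensor language.  Cell coordinates `Fin 9 = Fin (1 + 6 + 2)`: `s₀`, `P = {s₁..s₆}` (the support of `ω₆`), `F′ = {s₇, s₈}`.
Frame data: `hF1` (R2 frame), the descendant `t̄ = s₀∧ω₆` through its slices — `htbF` (no monomial through `F′`), `htbP` (for every `t ∈ P`
some slice `ι_{s_f} t̄` is `s₀ ∧ s_t`, i.e. the pairing `t ↦ t′` is onto `P`) — and the LIGHT STRUCTURE `G = ε·ι_{s₀}t̄ + s₀∧g`,
`Γ = ε′·ι_{s₀}t̄ + s₀∧γ` (`hG`, `hΓ`; `ι_{s₀}t̄ = ω₆`).  Then (E2) gives `A_{s₀,P} = 0` and `⟨A, ω⟩ = 0`, (E1) `⟨A, G⟩ = 0` becomes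
`g|_{F′}·α = 0` with `α = A_{s₀,F′}`, and the `F′ × F′` block of (E3) is `g αᵀ + γ βᵀ = 1₂` — contradiction by `tpl_R2_w6_core`.
NOT summit progress.
-/

set_option linter.dupNamespace false -- D-0017: single-problem summit ⇒ `QuantumAdvantage.QuantumAdvantage` by design

namespace Summit.QuantumAdvantage.QuantumAdvantage.Theorems.CubicForrelation.NearExactIsExact

open Finset Matrix

/-- **R2 leaf s₀ω₆, assembled.** [this work] -/
theorem tpa_R2_w6 (c d : Fin (3 + 9) → Fin (3 + 9) → Fin (3 + 9) → ZMod 2)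
    (hcs : ∀ p j k, c p k j = c p j k) (hcc : ∀ p j k, c j p k = c p j k) (hcd : ∀ p j, c p j j = 0)
    (hds : ∀ φ j k, d φ k j = d φ j k) (hdc : ∀ φ j k, d j φ k = d φ j k) (hdd : ∀ φ j, d φ j j = 0)
    (hpair : ∀ p φ, (∑ j, ∑ k, (if j < k then c p j k * d φ j k else 0)) = if p = φ then 1 else 0)
    (hF1 : ∀ j k, d (Fin.castAdd 9 0) j k =
      if (j = Fin.castAdd 9 1 ∧ k = Fin.castAdd 9 2) ∨ (j = Fin.castAdd 9 2 ∧ k = Fin.castAdd 9 1) then 1 else 0)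
    (htbF : ∀ (f : Fin 2) (s t : Fin (1 + 6 + 2)),
      d (Fin.natAdd 3 (Fin.natAdd (1 + 6) f)) (Fin.natAdd 3 s) (Fin.natAdd 3 t) = 0)
    (htbP : ∀ t : Fin 6, ∃ f : Fin 6, ∀ s u : Fin (1 + 6 + 2),
      d (Fin.natAdd 3 (Fin.castAdd 2 (Fin.natAdd 1 f))) (Fin.natAdd 3 s) (Fin.natAdd 3 u) =
        if (s = Fin.castAdd 2 (Fin.castAdd 6 0) ∧ u = Fin.castAdd 2 (Fin.natAdd 1 t)) ∨
           (u = Fin.castAdd 2 (Fin.castAdd 6 0) ∧ s = Fin.castAdd 2 (Fin.natAdd 1 t)) then 1 else 0)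
    (ε ε' : ZMod 2) (g γ : Fin (1 + 6 + 2) → ZMod 2)
    (hG : ∀ s t : Fin (1 + 6 + 2), d (Fin.castAdd 9 1) (Fin.natAdd 3 s) (Fin.natAdd 3 t) =
      ε * d (Fin.natAdd 3 (Fin.castAdd 2 (Fin.castAdd 6 0))) (Fin.natAdd 3 s) (Fin.natAdd 3 t) +
        (if s = Fin.castAdd 2 (Fin.castAdd 6 0) then g t else 0) + (if t = Fin.castAdd 2 (Fin.castAdd 6 0) then g s else 0))
    (hΓ : ∀ s t : Fin (1 + 6 + 2), d (Fin.castAdd 9 2) (Fin.natAdd 3 s) (Fin.natAdd 3 t) =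
      ε' * d (Fin.natAdd 3 (Fin.castAdd 2 (Fin.castAdd 6 0))) (Fin.natAdd 3 s) (Fin.natAdd 3 t) +
        (if s = Fin.castAdd 2 (Fin.castAdd 6 0) then γ t else 0) + (if t = Fin.castAdd 2 (Fin.castAdd 6 0) then γ s else 0)) :
    False := by
  -- notation-free abbreviations
  set z0 : Fin (1 + 6 + 2) := Fin.castAdd 2 (Fin.castAdd 6 0) with hz0
  have hE1 := (tpb_E1 c d hcs hcc hcd hds hdc hdd hpair hF1).1
  have hE2 := fun f => (tpb_E2 c d hcs hcc hcd hds hdc hdd hpair hF1 f).1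
  have hE3 := tpb_E3 c d hcs hcc hds hdc hdd hpair hF1
  -- A := ι_{y₂} c on the cells, as a function of two cell indices
  set A : Fin (1 + 6 + 2) → Fin (1 + 6 + 2) → ZMod 2 := fun s t => c (Fin.castAdd 9 1) (Fin.natAdd 3 s) (Fin.natAdd 3 t) with hA
  have hAs : ∀ s t, A t s = A s t := fun s t => hcs _ _ _
  have hAd : ∀ s, A s s = 0 := fun s => hcd _ _
  -- (1) A_{s₀, t} = 0 for t ∈ P, from (E2) at the slice f with ι_{s_f} t̄ = s₀ ∧ s_t
  have hz0_lt : ∀ t : Fin 6, z0 < Fin.castAdd 2 (Fin.natAdd 1 t) := fun t => by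
    rw [hz0, Fin.lt_def]; simp only [Fin.val_castAdd, Fin.val_natAdd]; omega
  have hAP : ∀ t : Fin 6, A z0 (Fin.castAdd 2 (Fin.natAdd 1 t)) = 0 := by
    intro t
    obtain ⟨f, hf⟩ := htbP t
    have h := hE2 (Fin.castAdd 2 (Fin.natAdd 1 f))
    -- the sum has exactly one non-zero `d`: at (s,u) = (z0, p_t) with z0 < p_t
    rw [Finset.sum_eq_single z0] at h
    · rw [Finset.sum_eq_single (Fin.castAdd 2 (Fin.natAdd 1 t))] at h
      · rw [if_pos (hz0_lt t), hf, if_pos (Or.inl ⟨rfl, rfl⟩), mul_one] at h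
        exact h
      · intro u _ hu
        rw [hf]
        by_cases hlt : z0 < u
        · rw [if_pos hlt, if_neg, mul_zero]
          rintro (⟨-, h1⟩ | ⟨h1, -⟩)
          · exact hu h1
          · exact absurd h1 (ne_of_gt hlt)
        · rw [if_neg hlt]
      · intro h0; exact absurd (Finset.mem_univ _) h0
    · intro s _ hs
      refine Finset.sum_eq_zero fun u _ => ?_
      rw [hf]
      by_cases hlt : s < u
      · rw [if_pos hlt, if_neg, mul_zero]
        rintro (⟨h1, -⟩ | ⟨h1, h2⟩)
        · exact hs h1
        · rw [h1] at hlt; rw [hz0] at hs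
          -- s = p_t and s < z0: impossible since z0 is the smallest index
          have : (Fin.castAdd 2 (Fin.natAdd 1 t) : Fin (1 + 6 + 2)) < Fin.castAdd 2 (Fin.castAdd 6 0) := h2 ▸ hlt
          rw [Fin.lt_def] at this; simp only [Fin.val_castAdd, Fin.val_natAdd] at this; omega
      · rw [if_neg hlt]
    · intro h0; exact absurd (Finset.mem_univ _) h0
  -- (2) ⟨A, ι_{s₀} t̄⟩ = 0 is (E2) at f = s₀
  have hAω := hE2 z0
  -- (3) ⟨A, G⟩ = 0 rewritten: Σ_t A_{z0,t} g_t = 0, then only t ∈ F′ survive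
  have hsumg : (∑ t, A z0 t * g t) = 0 := by
    -- expand G in (E1)
    have h := hE1
    have hexp : ∀ s t : Fin (1 + 6 + 2), (if s < t then A s t * d (Fin.castAdd 9 1) (Fin.natAdd 3 s) (Fin.natAdd 3 t) else 0) =
        ε * (if s < t then A s t * d (Fin.natAdd 3 z0) (Fin.natAdd 3 s) (Fin.natAdd 3 t) else 0) +
          (if s = z0 then A z0 t * g t else 0) * (if s < t then 1 else 0) := by
      intro s t
      rw [hG]
      by_cases hst : s < t
      · simp only [hst, if_true, mul_one]
        have ht0 : t ≠ z0 := fun h' => by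
          rw [h', hz0, Fin.lt_def] at hst; simp only [Fin.val_castAdd] at hst; omega
        rw [if_neg ht0, add_zero]
        by_cases hs0 : s = z0
        · rw [if_pos hs0, if_pos hs0, hs0]; ring
        · rw [if_neg hs0, if_neg hs0]; ring
      · simp only [hst, if_false, mul_zero, add_zero]
    simp only [hA] at h ⊢
    rw [Finset.sum_congr rfl fun s _ => Finset.sum_congr rfl fun t _ => hexp s t] at h
    simp only [Finset.sum_add_distrib, ← Finset.mul_sum] at h
    have hAω' : (∑ s, ∑ t, (if s < t then c (Fin.castAdd 9 1) (Fin.natAdd 3 s) (Fin.natAdd 3 t) *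
        d (Fin.natAdd 3 z0) (Fin.natAdd 3 s) (Fin.natAdd 3 t) else 0)) = 0 := hAω
    rw [hAω', mul_zero, zero_add, Finset.sum_eq_single z0] at h
    · simp only [if_true] at h
      rw [← h]
      refine Finset.sum_congr rfl fun t _ => ?_
      by_cases ht : z0 < t
      · rw [if_pos ht, mul_one]
      · rw [if_neg ht, mul_zero]
        have ht' : t = z0 := by
          rcases eq_or_lt_of_le (not_lt.1 ht) with h' | h'
          · exact h'
          · exfalso; rw [hz0, Fin.lt_def] at h'; simp only [Fin.val_castAdd] at h'; omega
        rw [ht']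
        show c (Fin.castAdd 9 1) (Fin.natAdd 3 z0) (Fin.natAdd 3 z0) * g z0 = 0
        rw [hcd, zero_mul]
    · intro s _ hs
      exact Finset.sum_eq_zero fun t _ => by rw [if_neg hs, zero_mul]
    · intro h0; exact absurd (Finset.mem_univ _) h0
  -- split the sum over Fin (1+6+2): the `s₀` and `P` terms vanish
  have hE1' : (∑ x : Fin 2, g (Fin.natAdd (1 + 6) x) * A z0 (Fin.natAdd (1 + 6) x)) = 0 := by
    rw [Fin.sum_univ_add, Fin.sum_univ_add, Fin.sum_univ_one] at hsumg
    have hP0 : (∑ i : Fin 6, A z0 (Fin.castAdd 2 (Fin.natAdd 1 i)) * g (Fin.castAdd 2 (Fin.natAdd 1 i))) = 0 :=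
      Finset.sum_eq_zero fun i _ => by rw [hAP i, zero_mul]
    rw [hP0, add_zero, show A z0 (Fin.castAdd 2 (Fin.castAdd 6 0)) = 0 from hAd z0, zero_mul, zero_add] at hsumg
    rw [← hsumg]
    exact Finset.sum_congr rfl fun x _ => mul_comm _ _
  -- (4) the F′ × F′ block of (E3)
  have hrow0 : ∀ (f : Fin 2) (s : Fin (1 + 6 + 2)), d (Fin.natAdd 3 z0) (Fin.natAdd 3 (Fin.natAdd (1 + 6) f)) (Fin.natAdd 3 s) = 0 := by
    intro f s; rw [hdc]; exact htbF f z0 s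
  have hfne : ∀ f : Fin 2, (Fin.natAdd (1 + 6) f : Fin (1 + 6 + 2)) ≠ z0 := fun f h' => by
    have := congrArg Fin.val h'; rw [hz0] at this; simp only [Fin.val_natAdd, Fin.val_castAdd] at this; omega
  have hiffF : ∀ r x : Fin 2, ((Fin.natAdd (1 + 6) r : Fin (1 + 6 + 2)) = Fin.natAdd (1 + 6) x) ↔ r = x := fun r x => by
    constructor
    · intro h'; have := congrArg Fin.val h'; simp only [Fin.val_natAdd] at this; exact Fin.ext (by omega)
    · rintro rfl; rfl
  have hblock : ∀ r x : Fin 2, g (Fin.natAdd (1 + 6) r) * A z0 (Fin.natAdd (1 + 6) x) +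
      γ (Fin.natAdd (1 + 6) r) * c (Fin.castAdd 9 2) (Fin.natAdd 3 z0) (Fin.natAdd 3 (Fin.natAdd (1 + 6) x)) = if r = x then 1 else 0 := by
    intro r x
    have h := hE3 (Fin.natAdd (1 + 6) r) (Fin.natAdd (1 + 6) x)
    have hτ : (∑ s, ∑ t, (if s < t then c (Fin.natAdd 3 (Fin.natAdd (1 + 6) x)) (Fin.natAdd 3 s) (Fin.natAdd 3 t) *
        d (Fin.natAdd 3 (Fin.natAdd (1 + 6) r)) (Fin.natAdd 3 s) (Fin.natAdd 3 t) else 0)) = 0 :=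
      Finset.sum_eq_zero fun s _ => Finset.sum_eq_zero fun t _ => by rw [htbF, mul_zero, ite_self]
    rw [hτ, add_zero] at h
    rw [show (if (Fin.natAdd (1 + 6) r : Fin (1 + 6 + 2)) = Fin.natAdd (1 + 6) x then (1 : ZMod 2) else 0) = if r = x then 1 else 0 from by
      by_cases hrx : r = x
      · rw [if_pos ((hiffF r x).2 hrx), if_pos hrx]
      · rw [if_neg (fun h' => hrx ((hiffF r x).1 h')), if_neg hrx]] at h
    rw [← h]
    -- G_{f,s} = [s = z0] g_f, Γ_{f,s} = [s = z0] γ_f for f ∈ F′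
    have hterm : ∀ s : Fin (1 + 6 + 2),
        d (Fin.castAdd 9 1) (Fin.natAdd 3 (Fin.natAdd (1 + 6) r)) (Fin.natAdd 3 s) * c (Fin.castAdd 9 1) (Fin.natAdd 3 s) (Fin.natAdd 3 (Fin.natAdd (1 + 6) x)) +
          d (Fin.castAdd 9 2) (Fin.natAdd 3 (Fin.natAdd (1 + 6) r)) (Fin.natAdd 3 s) * c (Fin.castAdd 9 2) (Fin.natAdd 3 s) (Fin.natAdd 3 (Fin.natAdd (1 + 6) x)) =
        if s = z0 then g (Fin.natAdd (1 + 6) r) * A z0 (Fin.natAdd (1 + 6) x) +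
          γ (Fin.natAdd (1 + 6) r) * c (Fin.castAdd 9 2) (Fin.natAdd 3 z0) (Fin.natAdd 3 (Fin.natAdd (1 + 6) x)) else 0 := by
      intro s
      rw [hG, hΓ, hrow0, mul_zero, zero_add, mul_zero, zero_add, if_neg (hfne r), if_neg (hfne r), zero_add, zero_add]
      by_cases hs : s = z0
      · rw [if_pos hs, if_pos hs, if_pos hs, hs]
      · rw [if_neg hs, if_neg hs, if_neg hs, zero_mul, zero_mul, add_zero]
    rw [Finset.sum_congr rfl fun s _ => hterm s, Finset.sum_ite_eq' Finset.univ z0]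
    simp
  exact tpl_R2_w6_core (fun r => g (Fin.natAdd (1 + 6) r)) (fun r => γ (Fin.natAdd (1 + 6) r))
    (fun x => A z0 (Fin.natAdd (1 + 6) x)) (fun x => c (Fin.castAdd 9 2) (Fin.natAdd 3 z0) (Fin.natAdd 3 (Fin.natAdd (1 + 6) x)))
    hblock hE1'

end Summit.QuantumAdvantage.QuantumAdvantage.Theorems.CubicForrelation.NearExactIsExact
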